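import Summits.ValiantsHypothesis.ValiantsHypothesis.Theorems.FifoMatchingNNDivisionHardLocatedRowsTemplateCeiling
import HarnessLib

/-!
(PART 11a of the port — `blockW` … `exists_common_pin_of_sparse`; the rest (`togetherFace_ud_block` … `exists_togetherFace_weight`) is `…LocatedRowsTogetherFaceWeight` (11b); split for the 400-line cap by the presser val-port-4 g3; texts verbatim.)
# LOCATED ROWS — part 11 — §7 the TOGETHER FACE (independent typing of 38 g2's sparse-cube certificate geometry, up to plumbing)

Theorems-side port (staged by val-idea-40 g5; press as `Theorems/FifoMatchingNNDivisionHardLocatedRowsTogetherFace.lean`,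
`--kind proof --supports stmt-ValiantsHypothesis-21181 --as helper`) of §7 of the crux workfile `Cruxes/NNDivisionHard/LocatedRows.lean`
REV 11 @80a90c42bbb7 (critic of record val-idea-crit-9 g2: V#81 rev 9 KEEP ★★ row 100, V#87 rev 11 KEEP ★★ row 108).  THEOREM OF
RECORD for «sparse-generator affine cubes are decided by C′» is 38 g2's `ExactPencil38` §12 `cor_add_sparseCube_bound` /
`cor_add_sparseCube_decided` (V#83 ★★★); this file is the complementary LocatedRows-currency typing of the same geometry.

* `blockW` (`W₀ = Σ_i (𝟙_{A_i}𝟙_{A_i}ᵀ − |A_i|·diag 𝟙_{A_i})`), `blockW_dotProduct_udPt` (`= Σ_i |b∩A_i|(|b∩A_i| − |A_i|)`),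
  `_nonpos`, ★ `_eq_zero_iff` (the together face), `hCOR_blockW = 0`, `_le_neg_one`, `blockW_tight_biUnion`, `card_reps_inter_biUnion`;
* `exists_common_pin` (finite avoidance), `exists_pin_of_vanishing_column` (constructive non-blocky pin), `exists_common_pin_of_sparse`;
* `togetherFace_ud_block` (UDISJ_k read), `cubePt_le_of_pins` (row-free common maximiser), `l1` bounds, `flat_smul'`,
  ★★ `exists_togetherFace_weight` (`W := λ•(c•blockW A + V)`: `hCOR W = 0`, face-tight, `|⟨udRow a, G t⟩| < |⟨W, G t⟩|` for all `a, t`).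

HONEST LABEL: support lemmas for an OPEN crux; the deciding theorem lives in 38 g2's file; 21181 `NNDivisionHard`, `ExactPencilLaw`
(C′), `allRows.Law`, COR-VIRTUAL are OPEN.  VP ≠ VNP is NOT proved here or anywhere in this tree.
-/

set_option autoImplicit false

-- the mandated summit-side namespace repeats a component by design (single-problem summit)
set_option linter.dupNamespace false

noncomputable section

open Matrix Finset
open scoped Pointwise

namespace Summit.ValiantsHypothesis.ValiantsHypothesis.Theorems.FifoMatching.LocatedRows

open Literature.Barriers.PneNP (HasEFOfSize three_pow_le_card_mul_two_pow_of_cover_univ)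
open Literature.Combinatorics.Optimization.FixedSizePsdRank (Cube bvec flat vecOuter corPolytope flat_dotProduct_vecOuter
  flat_dotProduct_le_of_mem_corPolytope)
open Summit.ValiantsHypothesis.ValiantsHypothesis.Theorems.FifoMatching.XcDivision
  (udInd udPt udRow udMat udInd_apply udInd_sq udInd_inter ud_data udRow_dotProduct_flat_diagonal flat_dotProduct_flat
    dot_le_of_mem_convexHull)
open Summit.ValiantsHypothesis.Theorems.NNDivisionHardNegative.CliqueRowBlind (sum_udInd_mem sum_udInd_univ)
open Summit.ValiantsHypothesis.ValiantsHypothesis.Theorems.FifoMatching.GridCorShadow (four_T_lt_two_pow)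
open Summit.ValiantsHypothesis.Theorems.NNDivisionHardNegative.DiagTilted
  (qOff qOffMat qOff_eq hasEFOfSize_qOff udRow_dotProduct_qOff udInd_compl udInd_univ)

section TogetherFace
variable {n : ℕ}



/-- The block weight `W₀ = Σ_i (𝟙_{A_i} 𝟙_{A_i}ᵀ − |A_i| · diag 𝟙_{A_i})` of a family of blocks. -/
def blockW {k : ℕ} (A : Fin k → Finset (Fin n)) : Matrix (Fin n) (Fin n) ℝ := fun x y =>
  ∑ i, (udInd (A i) x * udInd (A i) y - ((A i).card : ℝ) * udInd (A i) x * (if x = y then 1 else 0))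

/-- `⟨W₀, x_b x_bᵀ⟩ = Σ_i |b ∩ A_i| · (|b ∩ A_i| − |A_i|)`. -/
theorem blockW_dotProduct_udPt {k : ℕ} (A : Fin k → Finset (Fin n)) (b : Finset (Fin n)) :
    flat (blockW A) ⬝ᵥ udPt b = ∑ i, ((b ∩ A i).card : ℝ) * (((b ∩ A i).card : ℝ) - ((A i).card : ℝ)) := by
  classical
  rw [flat_dotProduct_udPt_eq]
  have step : ∑ p ∈ b, ∑ q ∈ b, blockW A p q
      = ∑ i, ∑ p ∈ b, ∑ q ∈ b,
          (udInd (A i) p * udInd (A i) q - ((A i).card : ℝ) * udInd (A i) p * (if p = q then 1 else 0)) := by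
    calc ∑ p ∈ b, ∑ q ∈ b, blockW A p q
        = ∑ p ∈ b, ∑ i, ∑ q ∈ b,
            (udInd (A i) p * udInd (A i) q - ((A i).card : ℝ) * udInd (A i) p * (if p = q then 1 else 0)) := by
          refine Finset.sum_congr rfl fun p _ => ?_
          unfold blockW
          exact Finset.sum_comm
      _ = _ := Finset.sum_comm
  rw [step]
  refine Finset.sum_congr rfl fun i _ => ?_
  have hδ : ∀ p ∈ b, ∑ q ∈ b, ((A i).card : ℝ) * udInd (A i) p * (if p = q then 1 else 0)
      = ((A i).card : ℝ) * udInd (A i) p := by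
    intro p hp
    simp only [mul_ite, mul_one, mul_zero, Finset.sum_ite_eq, if_pos hp]
  have inner : ∀ p ∈ b, ∑ q ∈ b,
      (udInd (A i) p * udInd (A i) q - ((A i).card : ℝ) * udInd (A i) p * (if p = q then 1 else 0))
        = udInd (A i) p * (∑ q ∈ b, udInd (A i) q) - ((A i).card : ℝ) * udInd (A i) p := by
    intro p hp
    rw [Finset.sum_sub_distrib, Finset.mul_sum, hδ p hp]
  rw [Finset.sum_congr rfl inner, Finset.sum_sub_distrib, ← Finset.sum_mul, ← Finset.mul_sum, sum_udInd_mem]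
  ring

/-- Every term is nonpositive: `⟨W₀, x_b x_bᵀ⟩ ≤ 0`. -/
theorem blockW_dotProduct_udPt_nonpos {k : ℕ} (A : Fin k → Finset (Fin n)) (b : Finset (Fin n)) :
    flat (blockW A) ⬝ᵥ udPt b ≤ 0 := by
  rw [blockW_dotProduct_udPt]
  refine Finset.sum_nonpos fun i _ => ?_
  have hle : ((b ∩ A i).card : ℝ) ≤ ((A i).card : ℝ) := by
    exact_mod_cast Finset.card_le_card Finset.inter_subset_right
  have h0 : (0 : ℝ) ≤ ((b ∩ A i).card : ℝ) := Nat.cast_nonneg _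
  nlinarith

/-- ★ THE TOGETHER FACE: `⟨W₀, x_b x_bᵀ⟩ = 0` iff `b` meets every block in `∅` or in the whole block. -/
theorem blockW_dotProduct_udPt_eq_zero_iff {k : ℕ} (A : Fin k → Finset (Fin n)) (b : Finset (Fin n)) :
    flat (blockW A) ⬝ᵥ udPt b = 0 ↔ ∀ i, b ∩ A i = ∅ ∨ A i ⊆ b := by
  classical
  rw [blockW_dotProduct_udPt]
  have hterm : ∀ i, ((b ∩ A i).card : ℝ) * (((b ∩ A i).card : ℝ) - ((A i).card : ℝ)) ≤ 0 := fun i => by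
    have hle : ((b ∩ A i).card : ℝ) ≤ ((A i).card : ℝ) := by
      exact_mod_cast Finset.card_le_card Finset.inter_subset_right
    have h0 : (0 : ℝ) ≤ ((b ∩ A i).card : ℝ) := Nat.cast_nonneg _
    nlinarith
  rw [Finset.sum_eq_zero_iff_of_nonpos fun i _ => hterm i]
  refine forall_congr' fun i => ?_
  simp only [Finset.mem_univ, forall_true_left]
  rw [mul_eq_zero, sub_eq_zero, Nat.cast_inj, Nat.cast_eq_zero, Finset.card_eq_zero]
  refine or_congr Iff.rfl ⟨fun h => ?_, fun h => ?_⟩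
  · have := Finset.eq_of_subset_of_card_le Finset.inter_subset_right h.ge
    exact this ▸ Finset.inter_subset_left
  · rw [Finset.inter_eq_right.2 h]

/-- `h_COR(W₀) = 0`: the together face is exposed with support value `0` (attained at `b = ∅`). -/
theorem hCOR_blockW {k : ℕ} (A : Fin k → Finset (Fin n)) : hCOR (blockW A) = 0 := by
  apply le_antisymm
  · obtain ⟨b, hb⟩ := exists_eq_hCOR (blockW A)
    rw [← hb]; exact blockW_dotProduct_udPt_nonpos A b
  · have h := le_hCOR (blockW A) ∅
    have h0 : flat (blockW A) ⬝ᵥ udPt (∅ : Finset (Fin n)) = 0 :=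
      (blockW_dotProduct_udPt_eq_zero_iff A ∅).2 fun i => Or.inl (Finset.empty_inter _)
    linarith

/-- OFF the together face the block weight is STRICTLY negative by at least `min_i (|A_i| − 1)`-margin per offending block; here
the qualitative form: `⟨W₀, x_b x_bᵀ⟩ ≤ −1` whenever some block is met partially (integrality). -/
theorem blockW_dotProduct_udPt_le_neg_one {k : ℕ} (A : Fin k → Finset (Fin n)) (b : Finset (Fin n))
    (hb : ¬ ∀ i, b ∩ A i = ∅ ∨ A i ⊆ b) : flat (blockW A) ⬝ᵥ udPt b ≤ -1 := by
  classical
  rw [← blockW_dotProduct_udPt_eq_zero_iff] at hb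
  have hle := blockW_dotProduct_udPt_nonpos A b
  -- the value is an integer
  have hint : ∃ z : ℤ, flat (blockW A) ⬝ᵥ udPt b = (z : ℝ) := by
    refine ⟨∑ i, ((b ∩ A i).card : ℤ) * (((b ∩ A i).card : ℤ) - ((A i).card : ℤ)), ?_⟩
    rw [blockW_dotProduct_udPt]; push_cast; rfl
  obtain ⟨z, hz⟩ := hint
  rw [hz] at hb hle ⊢
  have hz0 : z ≠ 0 := fun h => hb (by rw [h]; simp)
  have hzle : z ≤ 0 := by exact_mod_cast hle
  have : z ≤ -1 := by omega
  exact_mod_cast this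

/-- On the block unions `b_S = ⋃_{i ∈ S} A_i` of PAIRWISE DISJOINT blocks the block weight is TIGHT: the together face contains
the embedded `COR(k)` (`S ↦ b_S`). -/
theorem blockW_tight_biUnion {k : ℕ} (A : Fin k → Finset (Fin n)) (hA : ∀ i j, i ≠ j → Disjoint (A i) (A j))
    (S : Finset (Fin k)) : flat (blockW A) ⬝ᵥ udPt (S.biUnion A) = 0 := by
  classical
  refine (blockW_dotProduct_udPt_eq_zero_iff A _).2 fun i => ?_
  by_cases hi : i ∈ S
  · exact Or.inr (Finset.subset_biUnion_of_mem A hi)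
  · refine Or.inl (Finset.disjoint_iff_inter_eq_empty.1 ?_)
    exact Finset.disjoint_biUnion_left _ _ _ |>.2 fun j hj => hA j i (ne_of_mem_of_not_mem hj hi)

/-- … and the representative rows meet the block unions in UDISJ pattern: for representatives `x i ∈ A i` of pairwise disjoint
blocks, `|{x i : i ∈ α} ∩ b_S| = |α ∩ S|`. -/
theorem card_reps_inter_biUnion {k : ℕ} (A : Fin k → Finset (Fin n)) (hA : ∀ i j, i ≠ j → Disjoint (A i) (A j))
    (x : Fin k → Fin n) (hx : ∀ i, x i ∈ A i) (α S : Finset (Fin k)) :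
    ((α.image x) ∩ S.biUnion A).card = (α ∩ S).card := by
  classical
  have hinj : Function.Injective x := fun i j hij => by
    by_contra hne
    exact Finset.disjoint_left.1 (hA i j hne) (hx i) (hij ▸ hx j)
  have hmem : ∀ i, x i ∈ S.biUnion A ↔ i ∈ S := fun i => by
    constructor
    · intro h
      obtain ⟨j, hj, hij⟩ := Finset.mem_biUnion.1 h
      by_cases hji : j = i
      · exact hji ▸ hj
      · exact absurd (hx i) (Finset.disjoint_left.1 (hA j i hji) hij)
    · intro hi
      exact Finset.mem_biUnion.2 ⟨i, hi, hx i⟩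
  have : (α.image x) ∩ S.biUnion A = (α ∩ S).image x := by
    ext y
    simp only [Finset.mem_inter, Finset.mem_image]
    constructor
    · rintro ⟨⟨i, hi, rfl⟩, hy⟩
      exact ⟨i, ⟨hi, (hmem i).1 hy⟩, rfl⟩
    · rintro ⟨i, ⟨hi, hiS⟩, rfl⟩
      exact ⟨⟨i, hi, rfl⟩, (hmem i).2 hiS⟩
  rw [this, Finset.card_image_of_injective _ hinj]

/-- ★ GENERIC COMMON PIN (the «one non-mechanical step» of W7-K1, in kernel): if a property `P` of weight vectors is closed under
`0`, `+` and scalar multiples (e.g. `P V ↔ V ⊥ dir F`), and EACH test vector `g t` is seen by SOME `P`-vector, then ONE `P`-vector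
sees them ALL (finitely many hyperplanes do not cover a line through two of their complements: pick `c` off a finite bad set). -/
theorem exists_common_pin {d N : ℕ} (P : (Fin d → ℝ) → Prop) (hP0 : P 0) (hPadd : ∀ u v, P u → P v → P (u + v))
    (hPsmul : ∀ (c : ℝ) u, P u → P (c • u)) (g : Fin N → Fin d → ℝ)
    (hg : ∀ t, ∃ V, P V ∧ V ⬝ᵥ g t ≠ 0) : ∃ V, P V ∧ ∀ t, V ⬝ᵥ g t ≠ 0 := by
  classical
  suffices h : ∀ T : Finset (Fin N), ∃ V, P V ∧ ∀ t ∈ T, V ⬝ᵥ g t ≠ 0 by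
    obtain ⟨V, hV, hT⟩ := h Finset.univ
    exact ⟨V, hV, fun t => hT t (Finset.mem_univ t)⟩
  intro T
  induction T using Finset.induction_on with
  | empty => exact ⟨0, hP0, fun t ht => absurd ht (Finset.notMem_empty t)⟩
  | @insert t₀ T ht₀ ih =>
    obtain ⟨V, hV, hVT⟩ := ih
    obtain ⟨V', hV', hV't⟩ := hg t₀
    -- the finite set of bad parameters
    let bad : Finset ℝ := insert (-(V ⬝ᵥ g t₀) / (V' ⬝ᵥ g t₀)) (T.image fun t => -(V ⬝ᵥ g t) / (V' ⬝ᵥ g t))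
    obtain ⟨c, hc⟩ := Infinite.exists_notMem_finset bad
    refine ⟨V + c • V', hPadd _ _ hV (hPsmul c V' hV'), fun t ht => ?_⟩
    have hexp : (V + c • V') ⬝ᵥ g t = V ⬝ᵥ g t + c * (V' ⬝ᵥ g t) := by
      rw [add_dotProduct, smul_dotProduct, smul_eq_mul]
    rw [hexp]
    rcases Finset.mem_insert.1 ht with rfl | htT
    · intro h
      apply hc
      have : c = -(V ⬝ᵥ g t) / (V' ⬝ᵥ g t) := by
        rw [eq_div_iff hV't]; linarith
      rw [this]; exact Finset.mem_insert_self _ _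
    · by_cases hz : V' ⬝ᵥ g t = 0
      · rw [hz, mul_zero, add_zero]; exact hVT t htT
      · intro h
        apply hc
        have : c = -(V ⬝ᵥ g t) / (V' ⬝ᵥ g t) := by
          rw [eq_div_iff hz]; linarith
        rw [this]
        exact Finset.mem_insert_of_mem (Finset.mem_image.2 ⟨t, htT, rfl⟩)

/-- The explicit pin of ONE sparse generator: if `g x₀ y₀ ≠ 0`, `y₀ ∈ A j`, and some column `z ∈ A j` of `g` vanishes identically
(e.g. `z` outside the vertex support of `g`, which exists as soon as `|V(g)| < |A j|`), then `V := e_{x₀} (e_{y₀} − e_z)ᵀ` is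
ORTHOGONAL to the whole together face (`y₀, z` lie in the same block) and sees `g`: `⟨V, g⟩ = g x₀ y₀ ≠ 0` (38 g2's NON-BLOCKY
LEMMA, constructive form). -/
theorem exists_pin_of_vanishing_column {k : ℕ} (A : Fin k → Finset (Fin n)) (g : Matrix (Fin n) (Fin n) ℝ)
    {x₀ y₀ z : Fin n} (h0 : g x₀ y₀ ≠ 0) {j : Fin k} (hy : y₀ ∈ A j) (hz : z ∈ A j) (hgz : ∀ p, g p z = 0) :
    ∃ V : Matrix (Fin n) (Fin n) ℝ,
      (∀ b : Finset (Fin n), (∀ i, b ∩ A i = ∅ ∨ A i ⊆ b) → flat V ⬝ᵥ udPt b = 0) ∧ flat V ⬝ᵥ flat g ≠ 0 := by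
  classical
  refine ⟨fun p q => udInd {x₀} p * (udInd {y₀} q - udInd {z} q), fun b hb => ?_, ?_⟩
  · rw [flat_dotProduct_udPt_eq]
    have h1 : ∑ p ∈ b, ∑ q ∈ b, udInd {x₀} p * (udInd {y₀} q - udInd {z} q)
        = (∑ p ∈ b, udInd {x₀} p) * ∑ q ∈ b, (udInd {y₀} q - udInd {z} q) := by
      rw [Finset.sum_mul_sum]
    rw [h1, Finset.sum_sub_distrib, sum_udInd_mem, sum_udInd_mem, sum_udInd_mem]
    rcases hb j with hj | hj
    · have hy' : b ∩ {y₀} = ∅ := Finset.eq_empty_of_forall_notMem fun w hw => by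
        rw [Finset.mem_inter, Finset.mem_singleton] at hw
        have : y₀ ∈ b ∩ A j := Finset.mem_inter.2 ⟨hw.2 ▸ hw.1, hy⟩
        rw [hj] at this; exact absurd this (Finset.notMem_empty _)
      have hz' : b ∩ {z} = ∅ := Finset.eq_empty_of_forall_notMem fun w hw => by
        rw [Finset.mem_inter, Finset.mem_singleton] at hw
        have : z ∈ b ∩ A j := Finset.mem_inter.2 ⟨hw.2 ▸ hw.1, hz⟩
        rw [hj] at this; exact absurd this (Finset.notMem_empty _)
      rw [hy', hz']; simp
    · have hy' : b ∩ {y₀} = {y₀} := Finset.inter_singleton_of_mem (hj hy)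
      have hz' : b ∩ {z} = {z} := Finset.inter_singleton_of_mem (hj hz)
      rw [hy', hz']; simp
  · rw [flat_dotProduct_flat]
    have h2 : ∑ p, ∑ q, udInd {x₀} p * (udInd {y₀} q - udInd {z} q) * g p q = g x₀ y₀ - g x₀ z := by
      simp only [udInd_apply, Finset.mem_singleton]
      simp [Finset.sum_ite_eq', sub_mul, Finset.sum_sub_distrib, ite_mul, one_mul, zero_mul]
    rw [h2, hgz x₀, sub_zero]
    exact h0

/-- ★★ COMMON PIN FOR A SPARSE CUBE (W7-K1's non-mechanical step, DONE): if every generator `G t` has a nonzero entry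
`G t x₀ y₀ ≠ 0` together with a column `z` in `y₀`'s block on which `G t` vanishes (automatic when the vertex support of `G t` is
smaller than every block), then ONE weight `V` is orthogonal to the whole together face and sees EVERY generator. -/
theorem exists_common_pin_of_sparse {k N : ℕ} (A : Fin k → Finset (Fin n)) (G : Fin N → Matrix (Fin n) (Fin n) ℝ)
    (hG : ∀ t, ∃ x₀ y₀ z : Fin n, ∃ j : Fin k, G t x₀ y₀ ≠ 0 ∧ y₀ ∈ A j ∧ z ∈ A j ∧ ∀ p, G t p z = 0) :
    ∃ V : Matrix (Fin n) (Fin n) ℝ,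
      (∀ b : Finset (Fin n), (∀ i, b ∩ A i = ∅ ∨ A i ⊆ b) → flat V ⬝ᵥ udPt b = 0) ∧ ∀ t, flat V ⬝ᵥ flat (G t) ≠ 0 := by
  classical
  let P : (Fin (n * n) → ℝ) → Prop := fun w => ∀ b : Finset (Fin n), (∀ i, b ∩ A i = ∅ ∨ A i ⊆ b) → w ⬝ᵥ udPt b = 0
  have hP0 : P 0 := fun b _ => by simp
  have hPadd : ∀ u v, P u → P v → P (u + v) := fun u v hu hv b hb => by
    rw [add_dotProduct, hu b hb, hv b hb, add_zero]
  have hPsmul : ∀ (c : ℝ) u, P u → P (c • u) := fun c u hu b hb => by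
    rw [smul_dotProduct, hu b hb, smul_zero]
  have hg : ∀ t, ∃ w, P w ∧ w ⬝ᵥ flat (G t) ≠ 0 := fun t => by
    obtain ⟨x₀, y₀, z, j, h0, hy, hz, hgz⟩ := hG t
    obtain ⟨V, hV, hVg⟩ := exists_pin_of_vanishing_column A (G t) h0 hy hz hgz
    exact ⟨flat V, hV, hVg⟩
  obtain ⟨w, hw, hwt⟩ := exists_common_pin P hP0 hPadd hPsmul (fun t => flat (G t)) hg
  refine ⟨unflat w, fun b hb => ?_, fun t => ?_⟩
  · rw [flat_unflat]; exact hw b hb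
  · rw [flat_unflat]; exact hwt t


end TogetherFace

end Summit.ValiantsHypothesis.ValiantsHypothesis.Theorems.FifoMatching.LocatedRows
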